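import Literature.NumberTheory.EllipticCurves.CongruenceNumber
import Literature.NumberTheory.EllipticCurves.ModularDegreeMinimal
import Literature.NumberTheory.EllipticCurves.ModularJacobianModPMultiplicityOne
import Summits.ABC.ABC.Theses.DefiniteXi
import HarnessLib

/-!
# STUB-IDEAS k1 · GEN 16 companion sketch — `stub_xiDegreeComparison` (crux `SteinbergCore`, stmt-ABC-15024)

Scratch, not a Theorems file.  Three things, all elaborating (`lean check` rc 0, no `sorry`):

* §R  the proposed RE-CUT of registered stub 1 as SIGNATURES (`Sig.*`): the hypothesis-free stub is
      replaced by {`FreyModularity` (route item, by name), `OneSidedARS` (print debt, ARS 2012 Thm 2.1(b),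
      one direction, `p ≥ 5`), `XiCongruenceComparison` (PROVED: g11 certificate `xiCongruenceComparison`)}
      and the glue `Sig.recutGlue` (PROVED: g15 `stub_of_xiCongruenceComparison_oneSided`).
* §N1 the Family-1 import ladder for `OneSidedARS` from the TREE fact `wiles1995_multiplicityOne`
      (DDT Thm 4.26) along ARS §5 (Prop 5.4, Lemma 5.5, Lemma 5.8/Prop 5.9): abstract-algebra helper
      lemmas L1a/L1b/L2 (proved here), L3 (typed), and the two dictionaries `Dict_S`, `Dict_Lambda` (typed).
* nothing here restates or weakens the crux; the verbatim stub is `Stub1`.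
-/

set_option linter.dupNamespace false
set_option autoImplicit false

noncomputable section

namespace Summit.ABC.ABC.Cruxes.SteinbergCore.StubIdeasK1G16

open scoped MatrixGroups ModularForm
open CongruenceSubgroup
open Literature.NumberTheory.EllipticCurves Literature.NumberTheory.EllipticCurves.ModularForms
open Literature.NumberTheory.Automorphic

/-! ## §R — the re-cut of stub 1 (signatures) -/

/-- One-sided ARS at `p ≥ 5`, `p² ∤ N`, `D` of minimal degree among data with the same newform
(verbatim g15 `OneSidedARS`). [cite: AgasheRibetStein2012, Thm. 2.1(b)] -/
def OneSidedARS : Prop :=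
  ∀ (W : WeierstrassCurve ℚ) [W.IsElliptic] (N : ℕ) [NeZero N] (D : ModularParametrizationData W N),
    (∀ (W' : WeierstrassCurve ℚ) [W'.IsElliptic] (D' : ModularParametrizationData W' N),
        D'.f = D.f → D.modularDegree ≤ D'.modularDegree) →
      ∀ p : ℕ, p.Prime → 5 ≤ p → ¬ p ^ 2 ∣ N →
        padicValNat p (congruenceNumber D.f) ≤ padicValNat p D.modularDegree

/-- The tree's named fact (ARS Thm 2.1(b), equality, all `p`) gives the one-sided input. -/
theorem oneSidedARS_of_fact (h : padicValNat_congruenceNumber_eq_of_not_sq_dvd) : OneSidedARS :=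
  fun W _ N _ D hmin p hp _ hsq => (h W N D hmin p hp hsq).le

/-- Child 1♮ of the g11 certificate, verbatim: `cps ξ ≤ C_ε N^ε · cps(r_f)` for every newform `f`
of the Frey curve (PROVED in the crux dir as `xiCongruenceComparison`, 2791-line certificate). -/
def XiCongruenceComparison : Prop :=
  ∀ ε : ℝ, 0 < ε → ∃ C : ℝ, ∀ a b : ℤ, IsCoprime a b → a * b * (a + b) ≠ 0 → ∀ (N : ℕ) [NeZero N],
    (freyCurve a b).conductorNorm ℤ = N →
    ∀ Nm : ℕ, Odd Nm → Squarefree Nm → Odd Nm.primeFactors.card → Nm ∣ N →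
    brandtXi (N / Nm) Nm (fun n => (freyCurve a b).LFunction n) ≠ 0 →
    ∀ f : CuspForm (Gamma0 N) 2, IsNewformOf (freyCurve a b) f →
      ((brandtXi (N / Nm) Nm (fun n => (freyCurve a b).LFunction n) /
          (ordProj[2] (brandtXi (N / Nm) Nm (fun n => (freyCurve a b).LFunction n)) *
            ordProj[3] (brandtXi (N / Nm) Nm (fun n => (freyCurve a b).LFunction n))) : ℕ) : ℝ) ≤
        C * (N : ℝ) ^ ε *
          ((congruenceNumber f / (ordProj[2] (congruenceNumber f) * ordProj[3] (congruenceNumber f)) : ℕ) : ℝ)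

/-- The REGISTERED stub, verbatim (`Lines/p6_tamagawa_split.lean`, `stub_xiDegreeComparison`). -/
def Stub1 : Prop :=
    ∀ ε : ℝ, 0 < ε → ∃ C : ℝ, ∀ a b : ℤ, IsCoprime a b → a * b * (a + b) ≠ 0 → ∀ (N : ℕ) [NeZero N],
      (Literature.NumberTheory.EllipticCurves.freyCurve a b).conductorNorm ℤ = N →
      ∀ Nm : ℕ, Odd Nm → Squarefree Nm → Odd Nm.primeFactors.card → Nm ∣ N →
      Literature.NumberTheory.Automorphic.brandtXi (N / Nm) Nm
          (fun n => (Literature.NumberTheory.EllipticCurves.freyCurve a b).LFunction n) ≠ 0 →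
      ∃ D : Literature.NumberTheory.EllipticCurves.ModularForms.ModularParametrizationData
        (Literature.NumberTheory.EllipticCurves.freyCurve a b) N,
        (∀ D' : Literature.NumberTheory.EllipticCurves.ModularForms.ModularParametrizationData
          (Literature.NumberTheory.EllipticCurves.freyCurve a b) N, D.deg ≤ D'.deg) ∧
        ((Literature.NumberTheory.Automorphic.brandtXi (N / Nm) Nm
              (fun n => (Literature.NumberTheory.EllipticCurves.freyCurve a b).LFunction n) /
            (ordProj[2] (Literature.NumberTheory.Automorphic.brandtXi (N / Nm) Nm
                (fun n => (Literature.NumberTheory.EllipticCurves.freyCurve a b).LFunction n)) *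
              ordProj[3] (Literature.NumberTheory.Automorphic.brandtXi (N / Nm) Nm
                (fun n => (Literature.NumberTheory.EllipticCurves.freyCurve a b).LFunction n))) : ℕ) : ℝ) ≤
          C * (N : ℝ) ^ ε * ((D.deg / (ordProj[2] D.deg * ordProj[3] D.deg) : ℕ) : ℝ) *
            ((∏ q ∈ N.primeFactors, ((Literature.NumberTheory.EllipticCurves.freyCurve a b).minimalDiscriminantNorm
              ℤ).factorization q : ℕ) : ℝ) ^ 3

namespace Sig

/-- proposed `stub_freyModularity` — the route's own open item, BY NAME (not a new statement). -/
abbrev stubFreyModularity : Prop := Summit.ABC.ABC.Theses.DefiniteXi.FreyModularity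

/-- proposed `stub_oneSidedARSFrey` — the named print debt (M–L as a port; see §N1 for the in-tree ladder). -/
abbrev stubOneSidedARS : Prop := OneSidedARS

/-- proposed `stub_xiCongruenceComparison` — ALREADY PROVED (g11 certificate). -/
abbrev stubXiCongruenceComparison : Prop := XiCongruenceComparison

/-- proposed glue replacing the hypothesis-free stub 1 — ALREADY PROVED (g15 sketch,
`stub_of_xiCongruenceComparison_oneSided`). -/
abbrev recutGlue : Prop := XiCongruenceComparison → OneSidedARS → stubFreyModularity → Stub1

end Sig

/-! ## §N1 — algebra helper lemmas for importing `OneSidedARS` from `wiles1995_multiplicityOne`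

Dictionary (ARS 2012 §5 ↔ tree): `𝕋 = HeckeRing0 N 2`, `Λ = periodHomologyHecke N`, `J = J0 N = V/Λ`,
`𝔪 = (p, I_f)` the unique maximal ideal of residue characteristic `p` containing `I_f` (`𝕋/I_f ≅ ℤ`);
`𝕋' := {u ∈ End_ℤ Λ | ∃ n ≠ 0, n • u ∈ 𝕋}` (saturation of `𝕋` in `End J`; `End J ∩ 𝕋ℚ` = the elements
of `𝕋ℚ` preserving `Λ`).  Chain: Wiles (J[𝔪] and J[p]/𝔪 two-dimensional) ⟹(L1a,L1b) `Λ_𝔪 ≅ 𝕋_𝔪²`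
⟹(L2) `𝕋'_𝔪 = 𝕋_𝔪` ⟹(ARS L5.5: `S/R ↪ 𝕋'/𝕋`, supported at `𝔪`) `R_𝔪 = S_𝔪` ⟹(ARS P5.4 + Dict_S + L3 +
Dict_Lambda) `ord_p r_f ≤ ord_p m_E`. -/

/-- **L1a (Nakayama, generators).** Mathlib, by name: a submodule of a finite module over a local ring
mapping onto `M/𝔪M` is everything. -/
theorem helper_L1a_nakayama {R M : Type*} [CommRing R] [IsLocalRing R] [AddCommGroup M] [Module R M]
    [Module.Finite R M] (S : Submodule R M)
    (h : S.map (Submodule.mkQ (IsLocalRing.maximalIdeal R • ⊤)) = ⊤) : S = ⊤ :=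
  IsLocalRing.map_mkQ_eq_top.mp h

/-- **L1b (rank count ⟹ free).** A surjection `Rⁿ ↠ M` of `R`-modules which are finite free over a base
ring `O` (think `O = ℤ_p`, `R = 𝕋_𝔪`, `M = Ta_𝔪 J` or `Λ ⊗ ℤ_p` localised) with `rk_O M = n · rk_O R` is an
isomorphism (Orzech/Vasconcelos: a surjective endomorphism of a finite module is injective). -/
theorem helper_L1b_bijective_of_surjective_of_finrank_eq
    {O R M : Type*} [CommRing O] [Nontrivial O] [CommRing R] [Algebra O R] [AddCommGroup M] [Module R M]
    [Module O M] [IsScalarTower O R M] [Module.Free O R] [Module.Finite O R] [Module.Free O M]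
    [Module.Finite O M]
    {n : ℕ} (φ : (Fin n → R) →ₗ[R] M) (hφ : Function.Surjective φ)
    (hrank : Module.finrank O M = n * Module.finrank O R) : Function.Bijective φ := by
  classical
  refine ⟨?_, hφ⟩
  have hfin : Module.finrank O (Fin n → R) = n * Module.finrank O R := by
    rw [Module.finrank_pi_fintype, Finset.sum_const, Finset.card_univ, Fintype.card_fin, smul_eq_mul]
  obtain ⟨e⟩ := FiniteDimensional.nonempty_linearEquiv_of_finrank_eq (hrank.trans hfin.symm)
  have hsurj : Function.Surjective (e.toLinearMap ∘ₗ φ.restrictScalars O) := e.surjective.comp hφ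
  have hinj := OrzechProperty.injective_of_surjective_endomorphism _ hsurj
  exact Function.Injective.of_comp (f := e) hinj

/-- **L2 (saturation is scalar on a free module).** If `a ∈ A ⊇ R` (think `A = 𝕋_𝔪 ⊗ ℚ`, `R = 𝕋_𝔪`) maps the
`R`-points of the free module `A^{n+1}` into themselves, then `a ∈ R` (test on a basis vector). This is the
content of ARS Lemma 5.8 once L1 has made `Ta_𝔪 J` free of rank `2`. -/
theorem helper_L2_mem_range_of_preserves_points {R A : Type*} [CommRing R] [CommRing A] [Algebra R A]
    {n : ℕ} (a : A)
    (h : ∀ v : Fin (n + 1) → R, ∃ w : Fin (n + 1) → R,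
      (fun i => a * algebraMap R A (v i)) = fun i => algebraMap R A (w i)) :
    a ∈ Set.range (algebraMap R A) := by
  obtain ⟨w, hw⟩ := h (Pi.single 0 1)
  have h0 := congr_fun hw 0
  simp only [Pi.single_eq_same, map_one, mul_one] at h0
  exact ⟨w 0, h0.symm⟩

/-- **L3 (index duality under `Hom(−, ℤ)`), typed.** For a full-rank sublattice `P ≤ Λ`,
`#(Λ/P) = #(P^∨ / image of Λ^∨)` (Smith normal form).  Used to pass between the `S₂(ℤ)`-side quotient
defining `congruenceNumber` and the `𝕋`-side quotient `(𝕋_A ⊕ 𝕋_B)/𝕋` (ARS Def. 3.4, eq. (2)). -/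
def helper_L3_indexDuality : Prop :=
  ∀ (Λ : Type) [AddCommGroup Λ] [Module.Free ℤ Λ] [Module.Finite ℤ Λ] (P : Submodule ℤ Λ),
    Module.finrank ℤ P = Module.finrank ℤ Λ →
      Nat.card (Λ ⧸ P) = Nat.card (Module.Dual ℤ P ⧸ LinearMap.range P.subtype.dualMap)

/-- **Dict_S (q-expansion duality over `ℤ`), typed.** `S₂(Γ₀(N); ℤ) ≅ Hom_ℤ(𝕋_ℤ, ℤ)`, `g ↦ (t ↦ a₁(t g))`
(DDT 1995 §1.6 / Ribet; ARS p. 8 "Hom(T_B, ℤ) is the unique saturated Hecke-stable complement").  M–L. -/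
def Dict_S : Prop :=
  ∀ (N : ℕ) [NeZero N], ∃ e : integralCuspForms0 N 2 ≃ₗ[ℤ] (HeckeRing0 N 2 →+ ℤ),
    ∀ (g : integralCuspForms0 N 2) (t : HeckeRing0 N 2),
      ((e g t : ℤ) : ℂ) = cuspCoeff (HeckeRing0.toEnd N 2 t (g : CuspForm (Gamma0 N) 2)) 1

/-- The `B`-orthogonal of an additive subgroup (for `Dict_Lambda`). -/
def orthAddSubgroup {Λ : Type*} [AddCommGroup Λ] (B : Λ →+ Λ →+ ℤ) (P : AddSubgroup Λ) :
    AddSubgroup Λ where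
  carrier := {y | ∀ x ∈ P, B x y = 0}
  add_mem' := by
    intro a b ha hb x hx
    simp only [Set.mem_setOf_eq] at ha hb ⊢
    rw [map_add, ha x hx, hb x hx, add_zero]
  zero_mem' := by
    intro x _
    exact map_zero _
  neg_mem' := by
    intro a ha x hx
    simp only [Set.mem_setOf_eq] at ha ⊢
    rw [map_neg, ha x hx, neg_zero]

/-- **Dict_Lambda (degree = lattice index), typed — the XL item.** For `D` of minimal degree among data
with the same newform (ARS-optimal) and any perfect Hecke-self-adjoint pairing `B` on `Λ = H₁(X₀(N); ℤ)`
(tree fact `periodHomology_exists_heckeSelfAdjoint_perfectPairing`): `m_E² = #(Λ/(Λ[I_f] + Λ[I_f]^⊥))`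
(= `#(A ∩ B)`, ARS §3; Kohel–Stein ANTS-IV; Cremona §2; Zagier 1985).  Needs Riemann's bilinear
relations for `deg`; honest size XL. -/
def Dict_Lambda : Prop :=
  ∀ (N : ℕ) [NeZero N] (W : WeierstrassCurve ℚ) [W.IsElliptic] (D : ModularParametrizationData W N),
    (∀ (W' : WeierstrassCurve ℚ) [W'.IsElliptic] (D' : ModularParametrizationData W' N),
        D'.f = D.f → D.modularDegree ≤ D'.modularDegree) →
    ∀ B : periodHomologyHecke N →+ periodHomologyHecke N →+ ℤ, Function.Bijective B →
      (∀ (t : HeckeRing0 N 2) (x y : periodHomologyHecke N), B (t • x) y = B x (t • y)) →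
      D.modularDegree ^ 2 =
        Nat.card (periodHomologyHecke N ⧸
          ((Submodule.torsionBySet (HeckeRing0 N 2) (periodHomologyHecke N)
              {t : HeckeRing0 N 2 | HeckeRing0.toEnd N 2 t D.f = 0}).toAddSubgroup ⊔
            orthAddSubgroup B
              (Submodule.torsionBySet (HeckeRing0 N 2) (periodHomologyHecke N)
                {t : HeckeRing0 N 2 | HeckeRing0.toEnd N 2 t D.f = 0}).toAddSubgroup))

/-- Sanity: the registered stub follows from the three re-cut pieces and the (proved) glue — i.e. the
re-cut is a genuine cut of stub 1, nothing lost. -/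
theorem stub1_of_recut (hglue : Sig.recutGlue) (h1 : Sig.stubXiCongruenceComparison)
    (h2 : Sig.stubOneSidedARS) (h3 : Sig.stubFreyModularity) : Stub1 :=
  hglue h1 h2 h3

end Summit.ABC.ABC.Cruxes.SteinbergCore.StubIdeasK1G16

end
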